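import Summits.NavierStokesRegularity.FluidComputer.BlockStatics

/-!
# Fourier-block instance — §9 THE REGULATION SQUEEZE: energy bookkeeping of the CIRCUIT half

HONEST FRAMING. Low prior, high value-of-information experiment on Tao's machine paradigm; NOT a
claim that NS blows up. This file contains no Navier–Stokes input at all: it is plane geometry
and real arithmetic about the windows `Ain P`, `Aout P` of `BlockReadout` and the `dat` field of
`BlockStatics.Dynamics`. Its theorems constrain DESIGNS, not fluids.

WHAT IT DECIDES. `BlockStatics.Dynamics` splits into a CIRCUIT+CLOCK half (`Φ, τc, δsh, dat, unit,
clock` — design-level, finite-dimensional) and the IDEA-BOUND half (`shadow, leak`). Generation 31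
recorded the CIRCUIT half as "entirely doable" and warned that completing it with a cheap
contraction would make `shadow` dishonest. This file prices the CIRCUIT half by ENERGY
BOOKKEEPING: measure a planar gate `Φ` in the two-block energy `e(a, b) = a² + η b²` (block `n`
holds `a² E_n`, block `n + 1` holds `b² E_{n+1} = η b² E_n`). Then, for every gate inhabiting `dat`
between the fixed windows (`Dat`):

* `eta_le_of_passive`: if `e` never rises by more than `ε` along the circuit (`Passive … ε`; what
  the energy inequality gives when nothing flows INTO the pair during the tick), then
  `η (aLo + δsh)² ≤ (aLo − δ)² + ε`. On `Params.std` (`aLo = 3/2`, `δ = 1/2`) with `ε = 0` this is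
  `η ≤ 4/9 < 1/2`, i.e. `alphaEff < 2` (`std_alphaEff_lt_two`): NO passive gate completes
  `Params.std` at a viscosity-admissible efficiency. The thick core `δ = 1/2` chosen in gen 31 for
  the hand-off inequalities is incompatible with passive transfer at `η ≥ 1/2`; in general
  `(aLo + δsh)² ≤ 2 (aLo − δ)²` is necessary (`core_le_of_passive`).
* `delivery_le` / `delivery_corner`: if `e` never drops below `(1 − r) e` (`Delivers … r`; at most
  the fraction `r` of the pair energy is ever outside both blocks), then
  `(1 − r)((aHi + δ)² + η c0²) ≤ (σsp − δsh)² + η (aHi − δsh)²`.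
* `withholding_law` (η-free, both together):
  `(1 − r)(aHi + δ)² − (σsp − δsh)² ≤ ((aLo − δ)(aHi − δsh)/(aLo + δsh))²`. Corollaries: an
  energy-CONSERVING gate (`r = 0`) needs `(δ + δsh)(2 aHi + δ − δsh) < (σsp − δsh)²`
  (`conservative_needs_spent`) — with `δ` of the order of `aLo/3` that is `σsp > aLo`, absurd for a
  "spent" tolerance; and on `Params.std` every passive delivering gate has `r ≥ 7/10`
  (`std_withholding`): at the firing instant, from the strongest admissible input, at least 70% of
  the pair energy sits outside both blocks.

READING (words, not theorems). The passive bound constrains ANY passive two-block transfer with a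
thickened core; the delivery / withholding laws come from the UPPER readout window `aHi` only:
between BOUNDED windows a completing gate must regulate (`BlockRegulationGate` exhibits one), while
`BlockOpenWindow` / `BlockOpenGate` show `aHi` is inessential and the energy-conserving quarter turn
inhabits the half-open `dat`. ASSEMBLY §2g.9; no NS content.
-/

noncomputable section

open Set Metric

namespace Summit.NavierStokesRegularity.FluidComputer

open Literature.Analysis.FluidPDE.Tao2016
open Literature.Analysis.FluidPDE.FluidComputer

namespace BlockDesign

/-! ## Two-block energy and the three gate predicates -/

section Gates

variable {S : CascadeSpecs} (P : Params S)

/-- Two-block energy of a readout `(a, b)` in units of `E_n`: `a² + η b²`. [folklore] -/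
def pairEnergy (η : ℝ) (p : ℝ × ℝ) : ℝ := p.1 ^ 2 + η * p.2 ^ 2

/-- `pairEnergy` is nonnegative for `η ≥ 0`. [folklore] -/
theorem pairEnergy_nonneg {η : ℝ} (hη : 0 ≤ η) (p : ℝ × ℝ) : 0 ≤ pairEnergy η p := by
  unfold pairEnergy; positivity

/-- The `dat` field of `BlockStatics.Dynamics` as a predicate on a gate `Φ`, a rescaled cycle time
`τc` and a margin `δsh`: every admissible input is carried, at some instant of the cycle, into
`Aout` with margin `δsh`. [folklore] -/
def Dat (Φ : ℝ → ℝ × ℝ → ℝ × ℝ) (τc δsh : ℝ) : Prop :=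
  ∀ p ∈ Ain P, ∃ σ : ℝ, 0 ≤ σ ∧ σ ≤ τc ∧ Metric.closedBall (Φ σ p) δsh ⊆ Aout P

/-- PASSIVE with slack `ε`: along the circuit from admissible inputs the two-block energy never
exceeds its initial value by more than `ε` (in units of `E_n`). [folklore] -/
def Passive (Φ : ℝ → ℝ × ℝ → ℝ × ℝ) (τc ε : ℝ) : Prop :=
  ∀ p ∈ Ain P, ∀ σ : ℝ, 0 ≤ σ → σ ≤ τc → pairEnergy S.eta (Φ σ p) ≤ pairEnergy S.eta p + ε

/-- DELIVERING with withholding `r`: along the circuit the two-block energy never drops below the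
fraction `1 − r` of its initial value (at most the fraction `r` is outside both blocks). [folklore] -/
def Delivers (Φ : ℝ → ℝ × ℝ → ℝ × ℝ) (τc r : ℝ) : Prop :=
  ∀ p ∈ Ain P, ∀ σ : ℝ, 0 ≤ σ → σ ≤ τc → (1 - r) * pairEnergy S.eta p ≤ pairEnergy S.eta (Φ σ p)

variable {P}

/-- A residue's `dat` field is `Dat`. [folklore] -/
theorem Dynamics.dat_Dat {𝒟 : CascadeWaveletData 1 1} (Dy : Dynamics 𝒟 P) :
    Dat P Dy.Φ Dy.τc Dy.δsh := Dy.dat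

end Gates

/-! ## Window geometry (sup metric on `ℝ × ℝ`) -/
section Windows

variable {S : CascadeSpecs} (P : Params S)

/-- The base segment `(aLo − δ, aLo] × {0}` lies in `Ain`. [folklore] -/
theorem mem_Ain_base {a : ℝ} (h1 : P.aLo - P.δ < a) (h2 : a ≤ P.aLo) : (a, (0 : ℝ)) ∈ Ain P := by
  have hcore : (P.aLo, (0 : ℝ)) ∈ Acore P := by
    simp only [Acore, Set.mem_prod, Set.mem_Icc]
    exact ⟨⟨le_rfl, P.aLo_le_aHi⟩, by linarith [P.c0_nonneg], P.c0_nonneg⟩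
  refine ⟨(P.aLo, 0), hcore, ?_⟩
  rw [Prod.dist_eq, Real.dist_eq, dist_self]
  exact max_lt (by rw [abs_of_nonpos (by linarith)]; linarith) P.δ_pos

/-- The core corner `(aHi, c0)` lies in `Ain`. [folklore] -/
theorem mem_Ain_corner : (P.aHi, P.c0) ∈ Ain P := by
  have hcore : (P.aHi, P.c0) ∈ Acore P := by
    simp only [Acore, Set.mem_prod, Set.mem_Icc]
    exact ⟨⟨P.aLo_le_aHi, le_rfl⟩, by linarith [P.c0_nonneg], le_rfl⟩
  exact ⟨(P.aHi, P.c0), hcore, by rw [dist_self]; exact P.δ_pos⟩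

/-- The fattened corner `(aHi + δ − ε, c0)` lies in `Ain` for `0 < ε ≤ δ`. [folklore] -/
theorem mem_Ain_corner_fat {ε : ℝ} (hε : 0 < ε) (hεδ : ε ≤ P.δ) :
    (P.aHi + P.δ - ε, P.c0) ∈ Ain P := by
  have hcore : (P.aHi, P.c0) ∈ Acore P := by
    simp only [Acore, Set.mem_prod, Set.mem_Icc]
    exact ⟨⟨P.aLo_le_aHi, le_rfl⟩, by linarith [P.c0_nonneg], le_rfl⟩
  refine ⟨(P.aHi, P.c0), hcore, ?_⟩
  rw [Prod.dist_eq, Real.dist_eq, dist_self]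
  refine max_lt ?_ P.δ_pos
  rw [show P.aHi + P.δ - ε - P.aHi = P.δ - ε by ring, abs_of_nonneg (by linarith)]
  linarith

/-- FIRING BOUNDS: if the closed `δsh`-ball (sup metric) about `q = (x, y)` lies in `Aout`, then
`|x| + δsh ≤ σsp`, `aLo + δsh ≤ y` and `y + δsh ≤ aHi`. [folklore] -/
theorem fire_bounds {q : ℝ × ℝ} {δsh : ℝ} (hδ : 0 ≤ δsh)
    (h : Metric.closedBall q δsh ⊆ Aout P) :
    |q.1| + δsh ≤ P.σsp ∧ P.aLo + δsh ≤ q.2 ∧ q.2 + δsh ≤ P.aHi := by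
  have mem : ∀ x y : ℝ, |x - q.1| ≤ δsh → |y - q.2| ≤ δsh →
      (-P.σsp ≤ x ∧ x ≤ P.σsp) ∧ (P.aLo ≤ y ∧ y ≤ P.aHi) := by
    intro x y hx hy
    have hxy : (x, y) ∈ Aout P :=
      h (by rw [Metric.mem_closedBall, Prod.dist_eq, Real.dist_eq, Real.dist_eq]; exact max_le hx hy)
    simpa only [Aout, Set.mem_prod, Set.mem_Icc] using hxy
  have e1 : |q.1 + δsh - q.1| ≤ δsh := by
    rw [show q.1 + δsh - q.1 = δsh by ring, abs_of_nonneg hδ]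
  have e2 : |q.1 - δsh - q.1| ≤ δsh := by
    rw [show q.1 - δsh - q.1 = -δsh by ring, abs_neg, abs_of_nonneg hδ]
  have e3 : |q.2 + δsh - q.2| ≤ δsh := by
    rw [show q.2 + δsh - q.2 = δsh by ring, abs_of_nonneg hδ]
  have e4 : |q.2 - δsh - q.2| ≤ δsh := by
    rw [show q.2 - δsh - q.2 = -δsh by ring, abs_neg, abs_of_nonneg hδ]
  have e0x : |q.1 - q.1| ≤ δsh := by rw [sub_self, abs_zero]; exact hδ
  have e0y : |q.2 - q.2| ≤ δsh := by rw [sub_self, abs_zero]; exact hδ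
  refine ⟨?_, ?_, ?_⟩
  · rcases le_or_gt 0 q.1 with hq | hq
    · have := (mem _ _ e1 e0y).1.2
      rw [abs_of_nonneg hq]; linarith
    · have := (mem _ _ e2 e0y).1.1
      rw [abs_of_neg hq]; linarith
  · have := (mem _ _ e0x e4).2.1
    linarith
  · have := (mem _ _ e0x e3).2.2
    linarith

/-- If `Dat` holds at all then the output window is at least `2 δsh` tall above `aLo + δsh ≥ 1`:
`aLo + 2 δsh ≤ aHi`, and `δsh ≤ σsp`. [folklore] -/
theorem window_of_Dat {Φ : ℝ → ℝ × ℝ → ℝ × ℝ} {τc δsh : ℝ} (hδ : 0 ≤ δsh) (hD : Dat P Φ τc δsh) :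
    P.aLo + 2 * δsh ≤ P.aHi ∧ δsh ≤ P.σsp := by
  obtain ⟨σ, -, -, hball⟩ := hD (P.aLo, 0) (mem_Ain_base P (by linarith [P.δ_pos]) le_rfl)
  obtain ⟨hx, hy1, hy2⟩ := fire_bounds P hδ hball
  exact ⟨by linarith, by linarith [abs_nonneg (Φ σ (P.aLo, 0)).1]⟩

end Windows

/-! ## Two limit helpers (closing the open fattening `dist < δ`) -/
section Limits

/-- If `C ≤ (d + ε)²` for all `0 < ε ≤ δ` (`d ≥ 0`, `δ > 0`), then `C ≤ d²`. [folklore] -/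
theorem le_sq_of_forall_pos {C d δ : ℝ} (hd : 0 ≤ d) (hδ : 0 < δ)
    (h : ∀ ε : ℝ, 0 < ε → ε ≤ δ → C ≤ (d + ε) ^ 2) : C ≤ d ^ 2 := by
  by_contra hC
  have hC := not_le.1 hC
  have hM : 0 < 2 * (2 * d + δ + 1) := by linarith
  set ε : ℝ := min δ ((C - d ^ 2) / (2 * (2 * d + δ + 1))) with hε_def
  have hεpos : 0 < ε := lt_min hδ (div_pos (by linarith) hM)
  have hεδ : ε ≤ δ := min_le_left _ _
  have hεM : ε * (2 * (2 * d + δ + 1)) ≤ C - d ^ 2 := by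
    have := min_le_right δ ((C - d ^ 2) / (2 * (2 * d + δ + 1)))
    rwa [← hε_def, le_div_iff₀ hM] at this
  have h1 := h ε hεpos hεδ
  have h2 : (d + ε) ^ 2 ≤ d ^ 2 + ε * (2 * d + δ) := by
    nlinarith [mul_nonneg hεpos.le (sub_nonneg.2 hεδ)]
  nlinarith

/-- If `k (d − ε)² ≤ C` for all `0 < ε ≤ δ` (`k ≥ 0`, `0 < δ ≤ d`), then `k d² ≤ C`. [folklore] -/
theorem mul_sq_le_of_forall_pos {k d δ C : ℝ} (hk : 0 ≤ k) (hδ : 0 < δ) (hd : δ ≤ d)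
    (h : ∀ ε : ℝ, 0 < ε → ε ≤ δ → k * (d - ε) ^ 2 ≤ C) : k * d ^ 2 ≤ C := by
  by_contra hC
  have hC := not_le.1 hC
  have hkd : 0 ≤ k * d := mul_nonneg hk (by linarith)
  have hM : 0 < 2 * (2 * (k * d) + 1) := by linarith
  set ε : ℝ := min δ ((k * d ^ 2 - C) / (2 * (2 * (k * d) + 1))) with hε_def
  have hεpos : 0 < ε := lt_min hδ (div_pos (by linarith) hM)
  have hεδ : ε ≤ δ := min_le_left _ _
  have hεM : ε * (2 * (2 * (k * d) + 1)) ≤ k * d ^ 2 - C := by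
    have := min_le_right δ ((k * d ^ 2 - C) / (2 * (2 * (k * d) + 1)))
    rwa [← hε_def, le_div_iff₀ hM] at this
  have h1 := h ε hεpos hεδ
  have h2 : k * d ^ 2 - 2 * (k * d) * ε ≤ k * (d - ε) ^ 2 := by
    nlinarith [mul_nonneg hk (sq_nonneg ε)]
  nlinarith

end Limits

/-! ## The passive bound: `η (aLo + δsh)² ≤ (aLo − δ)² + ε` -/
section PassiveBound

variable {S : CascadeSpecs} (P : Params S)

/-- Pointwise passive bound: firing from `(a, 0)` with `aLo − δ < a ≤ aLo` needs
`η (aLo + δsh)² ≤ a² + ε`. [folklore] -/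
theorem eta_sq_le_of_passive {Φ : ℝ → ℝ × ℝ → ℝ × ℝ} {τc δsh ε : ℝ} (hδsh : 0 ≤ δsh)
    (hP : Passive P Φ τc ε) (hD : Dat P Φ τc δsh) {a : ℝ} (h1 : P.aLo - P.δ < a) (h2 : a ≤ P.aLo) :
    S.eta * (P.aLo + δsh) ^ 2 ≤ a ^ 2 + ε := by
  obtain ⟨σ, hσ0, hσ1, hball⟩ := hD (a, 0) (mem_Ain_base P h1 h2)
  obtain ⟨-, hy, -⟩ := fire_bounds P hδsh hball
  have hpass : (Φ σ (a, 0)).1 ^ 2 + S.eta * (Φ σ (a, 0)).2 ^ 2 ≤ a ^ 2 + S.eta * 0 ^ 2 + ε :=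
    hP (a, 0) (mem_Ain_base P h1 h2) σ hσ0 hσ1
  have hy0 : 0 ≤ P.aLo + δsh := by linarith [P.one_le_aLo]
  have h3 : (P.aLo + δsh) ^ 2 ≤ (Φ σ (a, 0)).2 ^ 2 := pow_le_pow_left₀ hy0 hy 2
  have h4 := mul_le_mul_of_nonneg_left h3 S.eta_pos.le
  nlinarith [sq_nonneg (Φ σ (a, 0)).1]

/-- **Passive bound.** `η (aLo + δsh)² ≤ (aLo − δ)² + ε` for every `ε`-passive gate inhabiting
`Dat`: the weakest admissible input must still lift the output to `aLo + δsh`. [folklore] -/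
theorem eta_le_of_passive {Φ : ℝ → ℝ × ℝ → ℝ × ℝ} {τc δsh ε : ℝ} (hδsh : 0 ≤ δsh)
    (hP : Passive P Φ τc ε) (hD : Dat P Φ τc δsh) :
    S.eta * (P.aLo + δsh) ^ 2 ≤ (P.aLo - P.δ) ^ 2 + ε := by
  have key := le_sq_of_forall_pos (C := S.eta * (P.aLo + δsh) ^ 2 - ε) (d := P.aLo - P.δ)
    (by linarith [P.one_le]) P.δ_pos (fun e he heδ => by
      have := eta_sq_le_of_passive P hδsh hP hD (a := P.aLo - P.δ + e) (by linarith) (by linarith)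
      linarith)
  linarith

/-- Viscosity reading: at `η ≥ 1/2` (i.e. `alphaEff ≥ 2`) a `0`-passive gate needs
`(aLo + δsh)² ≤ 2 (aLo − δ)²`; in particular `δ < 0.3 aLo`. [folklore] -/
theorem core_le_of_passive {Φ : ℝ → ℝ × ℝ → ℝ × ℝ} {τc δsh : ℝ} (hδsh : 0 ≤ δsh)
    (hη : 1 / 2 ≤ S.eta) (hP : Passive P Φ τc 0) (hD : Dat P Φ τc δsh) :
    (P.aLo + δsh) ^ 2 ≤ 2 * (P.aLo - P.δ) ^ 2 := by
  have h := eta_le_of_passive P hδsh hP hD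
  nlinarith [sq_nonneg (P.aLo + δsh)]

/-- A residue with an `ε`-passive circuit obeys the passive bound with its own `δsh`. [folklore] -/
theorem Dynamics.eta_le_of_passive {𝒟 : CascadeWaveletData 1 1} (Dy : Dynamics 𝒟 P) {ε : ℝ}
    (hP : Passive P Dy.Φ Dy.τc ε) : S.eta * (P.aLo + Dy.δsh) ^ 2 ≤ (P.aLo - P.δ) ^ 2 + ε :=
  BlockDesign.eta_le_of_passive P Dy.δsh_nonneg hP Dy.dat

end PassiveBound

/-! ## The delivery bound and the withholding law -/
section Withholding

variable {S : CascadeSpecs} (P : Params S)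

/-- Pointwise delivery bound: `(1 − r) e(p) ≤ (σsp − δsh)² + η (aHi − δsh)²` for every admissible
input `p`, since the firing point has `|x| ≤ σsp − δsh` and `0 ≤ y ≤ aHi − δsh`. [folklore] -/
theorem delivery_le {Φ : ℝ → ℝ × ℝ → ℝ × ℝ} {τc δsh r : ℝ} (hδsh : 0 ≤ δsh)
    (hDel : Delivers P Φ τc r) (hD : Dat P Φ τc δsh) {p : ℝ × ℝ} (hp : p ∈ Ain P) :
    (1 - r) * pairEnergy S.eta p ≤ (P.σsp - δsh) ^ 2 + S.eta * (P.aHi - δsh) ^ 2 := by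
  obtain ⟨σ, hσ0, hσ1, hball⟩ := hD p hp
  obtain ⟨hx, hy1, hy2⟩ := fire_bounds P hδsh hball
  have hdel : (1 - r) * pairEnergy S.eta p ≤ (Φ σ p).1 ^ 2 + S.eta * (Φ σ p).2 ^ 2 :=
    hDel p hp σ hσ0 hσ1
  have hx' : (Φ σ p).1 ^ 2 ≤ (P.σsp - δsh) ^ 2 := by
    have h0 : |(Φ σ p).1| ≤ P.σsp - δsh := by linarith
    calc (Φ σ p).1 ^ 2 = |(Φ σ p).1| ^ 2 := (sq_abs _).symm
      _ ≤ (P.σsp - δsh) ^ 2 := pow_le_pow_left₀ (abs_nonneg _) h0 2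
  have hy' : (Φ σ p).2 ^ 2 ≤ (P.aHi - δsh) ^ 2 :=
    pow_le_pow_left₀ (by linarith [P.one_le_aLo]) (by linarith) 2
  have h4 := mul_le_mul_of_nonneg_left hy' S.eta_pos.le
  linarith

/-- Delivery bound at the core corner `(aHi, c0)`. [folklore] -/
theorem delivery_corner {Φ : ℝ → ℝ × ℝ → ℝ × ℝ} {τc δsh r : ℝ} (hδsh : 0 ≤ δsh)
    (hDel : Delivers P Φ τc r) (hD : Dat P Φ τc δsh) :
    (1 - r) * (P.aHi ^ 2 + S.eta * P.c0 ^ 2) ≤ (P.σsp - δsh) ^ 2 + S.eta * (P.aHi - δsh) ^ 2 :=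
  delivery_le P hδsh hDel hD (mem_Ain_corner P)

/-- Delivery bound at the fattened corner (limit over `(aHi + δ − ε, c0)`), for `r ≤ 1`:
`(1 − r)((aHi + δ)² + η c0²) ≤ (σsp − δsh)² + η (aHi − δsh)²`. [folklore] -/
theorem delivery_corner_fat {Φ : ℝ → ℝ × ℝ → ℝ × ℝ} {τc δsh r : ℝ} (hδsh : 0 ≤ δsh) (hr : r ≤ 1)
    (hDel : Delivers P Φ τc r) (hD : Dat P Φ τc δsh) :
    (1 - r) * ((P.aHi + P.δ) ^ 2 + S.eta * P.c0 ^ 2) ≤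
      (P.σsp - δsh) ^ 2 + S.eta * (P.aHi - δsh) ^ 2 := by
  have key := mul_sq_le_of_forall_pos (k := 1 - r) (d := P.aHi + P.δ) (δ := P.δ)
    (C := (P.σsp - δsh) ^ 2 + S.eta * (P.aHi - δsh) ^ 2 - (1 - r) * (S.eta * P.c0 ^ 2))
    (by linarith) P.δ_pos (by linarith [P.one_le_aLo, P.aLo_le_aHi]) (fun e he heδ => by
      have h := delivery_le P hδsh hDel hD (mem_Ain_corner_fat P he heδ)
      simp only [pairEnergy] at h
      linarith)
  linarith

/-- **Withholding law** (η-free): a `0`-passive, `(1 − r)`-delivering gate inhabiting `Dat` obeys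
`(1 − r)(aHi + δ)² − (σsp − δsh)² ≤ ((aLo − δ)(aHi − δsh)/(aLo + δsh))²`. [folklore] -/
theorem withholding_law {Φ : ℝ → ℝ × ℝ → ℝ × ℝ} {τc δsh r : ℝ} (hδsh : 0 ≤ δsh) (hr : r ≤ 1)
    (hP : Passive P Φ τc 0) (hDel : Delivers P Φ τc r) (hD : Dat P Φ τc δsh) :
    (1 - r) * (P.aHi + P.δ) ^ 2 - (P.σsp - δsh) ^ 2 ≤
      ((P.aLo - P.δ) * (P.aHi - δsh) / (P.aLo + δsh)) ^ 2 := by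
  have hη := eta_le_of_passive P hδsh hP hD
  have hc := delivery_corner_fat P hδsh hr hDel hD
  have hL : 0 < P.aLo + δsh := by linarith [P.one_le_aLo]
  rw [div_pow, le_div_iff₀ (pow_pos hL 2), mul_pow]
  have h1 : (1 - r) * (P.aHi + P.δ) ^ 2 - (P.σsp - δsh) ^ 2 ≤ S.eta * (P.aHi - δsh) ^ 2 := by
    have : 0 ≤ (1 - r) * (S.eta * P.c0 ^ 2) :=
      mul_nonneg (by linarith) (mul_nonneg S.eta_pos.le (sq_nonneg _))
    linarith
  calc ((1 - r) * (P.aHi + P.δ) ^ 2 - (P.σsp - δsh) ^ 2) * (P.aLo + δsh) ^ 2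
      ≤ S.eta * (P.aHi - δsh) ^ 2 * (P.aLo + δsh) ^ 2 :=
        mul_le_mul_of_nonneg_right h1 (sq_nonneg _)
    _ = S.eta * (P.aLo + δsh) ^ 2 * (P.aHi - δsh) ^ 2 := by ring
    _ ≤ (P.aLo - P.δ) ^ 2 * (P.aHi - δsh) ^ 2 :=
        mul_le_mul_of_nonneg_right (by linarith) (sq_nonneg _)

/-- No energy-conserving completion: a `0`-passive, `1`-delivering (`r = 0`) gate inhabiting `Dat`
needs a spent tolerance with `(δ + δsh)(2 aHi + δ − δsh) < (σsp − δsh)²`. [folklore] -/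
theorem conservative_needs_spent {Φ : ℝ → ℝ × ℝ → ℝ × ℝ} {τc δsh : ℝ} (hδsh : 0 ≤ δsh)
    (hP : Passive P Φ τc 0) (hDel : Delivers P Φ τc 0) (hD : Dat P Φ τc δsh) :
    (P.δ + δsh) * (2 * P.aHi + P.δ - δsh) < (P.σsp - δsh) ^ 2 := by
  have hw := withholding_law P hδsh zero_le_one hP hDel hD
  obtain ⟨hwin, -⟩ := window_of_Dat P hδsh hD
  have hL : 0 < P.aLo + δsh := by linarith [P.one_le_aLo]
  have hA : 0 < P.aHi - δsh := by linarith [P.one_le_aLo]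
  have hq : (P.aLo - P.δ) * (P.aHi - δsh) / (P.aLo + δsh) < P.aHi - δsh := by
    rw [div_lt_iff₀ hL]; nlinarith [P.δ_pos]
  have hq0 : 0 ≤ (P.aLo - P.δ) * (P.aHi - δsh) / (P.aLo + δsh) :=
    div_nonneg (mul_nonneg (by linarith [P.one_le]) hA.le) hL.le
  have hq2 : ((P.aLo - P.δ) * (P.aHi - δsh) / (P.aLo + δsh)) ^ 2 < (P.aHi - δsh) ^ 2 :=
    pow_lt_pow_left₀ hq hq0 two_ne_zero
  nlinarith

/-- A residue whose circuit is `0`-passive and `(1 − r)`-delivering obeys the withholding law with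
its own `δsh`. [folklore] -/
theorem Dynamics.withholding {𝒟 : CascadeWaveletData 1 1} (Dy : Dynamics 𝒟 P) {r : ℝ} (hr : r ≤ 1)
    (hP : Passive P Dy.Φ Dy.τc 0) (hDel : Delivers P Dy.Φ Dy.τc r) :
    (1 - r) * (P.aHi + P.δ) ^ 2 - (P.σsp - Dy.δsh) ^ 2 ≤
      ((P.aLo - P.δ) * (P.aHi - Dy.δsh) / (P.aLo + Dy.δsh)) ^ 2 :=
  withholding_law P Dy.δsh_nonneg hr hP hDel Dy.dat

end Withholding

/-! ## The squeeze on `Params.std` -/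
section Std

variable (S : CascadeSpecs) (hS : S.lam0 = 1) (hη : 1 / 4 < S.eta)

/-- On `Params.std` an `ε`-passive gate inhabiting `Dat` forces `η ≤ (4/9)(1 + ε)`. [folklore] -/
theorem std_eta_le {Φ : ℝ → ℝ × ℝ → ℝ × ℝ} {τc δsh ε : ℝ} (hδsh : 0 ≤ δsh)
    (hP : Passive (Params.std S hS hη) Φ τc ε) (hD : Dat (Params.std S hS hη) Φ τc δsh) :
    S.eta ≤ 4 / 9 * (1 + ε) := by
  have h : S.eta * (3 / 2 + δsh) ^ 2 ≤ (3 / 2 - 1 / 2) ^ 2 + ε :=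
    eta_le_of_passive (Params.std S hS hη) hδsh hP hD
  have h9 : (9 / 4 : ℝ) ≤ (3 / 2 + δsh) ^ 2 := by nlinarith
  nlinarith [S.eta_pos]

/-- **The squeeze.** No `0`-passive gate completes `Params.std` at a viscosity-admissible
efficiency: `Passive ∧ Dat` force `η ≤ 4/9 < 1/2`, i.e. `alphaEff < 2`. [folklore] -/
theorem std_alphaEff_lt_two {Φ : ℝ → ℝ × ℝ → ℝ × ℝ} {τc δsh : ℝ} (hδsh : 0 ≤ δsh)
    (hP : Passive (Params.std S hS hη) Φ τc 0) (hD : Dat (Params.std S hS hη) Φ τc δsh) :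
    S.alphaEff < 2 := by
  have h := std_eta_le S hS hη hδsh hP hD
  have hlt : ¬ (1 / 2 : ℝ) ≤ S.eta := by linarith
  exact not_le.1 (fun h2 => hlt (S.two_le_alphaEff_iff.1 h2))

/-- On `Params.std` a `0`-passive `(1 − r)`-delivering gate inhabiting `Dat` withholds `r ≥ 7/10`
of the pair energy. [folklore] -/
theorem std_withholding {Φ : ℝ → ℝ × ℝ → ℝ × ℝ} {τc δsh r : ℝ} (hδsh : 0 ≤ δsh) (hr : r ≤ 1)
    (hP : Passive (Params.std S hS hη) Φ τc 0) (hDel : Delivers (Params.std S hS hη) Φ τc r)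
    (hD : Dat (Params.std S hS hη) Φ τc δsh) : 7 / 10 ≤ r := by
  have hw : (1 - r) * (2 + 1 / 2) ^ 2 - (1 / 4 - δsh) ^ 2 ≤
      ((3 / 2 - 1 / 2) * (2 - δsh) / (3 / 2 + δsh)) ^ 2 :=
    withholding_law (Params.std S hS hη) hδsh hr hP hDel hD
  have hwin : (3 / 2 : ℝ) + 2 * δsh ≤ 2 ∧ δsh ≤ 1 / 4 := window_of_Dat (Params.std S hS hη) hδsh hD
  have hq : (3 / 2 - 1 / 2) * (2 - δsh) / (3 / 2 + δsh) ≤ 4 / 3 := by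
    rw [div_le_iff₀ (by linarith)]; linarith
  have hq0 : 0 ≤ (3 / 2 - 1 / 2) * (2 - δsh) / (3 / 2 + δsh) :=
    div_nonneg (by linarith) (by linarith)
  have hq2 : ((3 / 2 - 1 / 2) * (2 - δsh) / (3 / 2 + δsh)) ^ 2 ≤ (4 / 3) ^ 2 :=
    pow_le_pow_left₀ hq0 hq 2
  have hs : (1 / 4 - δsh) ^ 2 ≤ 1 / 16 := by nlinarith
  nlinarith

/-- Residue form of the squeeze: a residue for `Params.std` with a `0`-passive circuit lives at
`alphaEff < 2`. [folklore] -/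
theorem Dynamics.std_alphaEff_lt_two {𝒟 : CascadeWaveletData 1 1}
    (Dy : Dynamics 𝒟 (Params.std S hS hη)) (hP : Passive (Params.std S hS hη) Dy.Φ Dy.τc 0) :
    S.alphaEff < 2 :=
  BlockDesign.std_alphaEff_lt_two S hS hη Dy.δsh_nonneg hP Dy.dat

end Std

end BlockDesign

end Summit.NavierStokesRegularity.FluidComputer

end
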